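import Summits.QuantumFields.BalabanUV.T4Continuum.Support.NE9TorusIneq126ChainSum

/-!
# NE9TorusIneq229Chain — [II] (2.29) and the `Ineq126Printed`∕`hTree` shape on the cell's TORUS system from the BLOCK-CHAIN (1.26):
# `δκ ≥ κ₁(d) + s′ + a₂`, `α₆·e^{a₂}·(2^d·2^(2^d) + 2^{d+1}Γ³e^{−s′})·4·2^d ≤ a₂` (d = 4, s′ = 64, a₂ = 1: **`δκ ≥ 145` and `e·64·(2²⁰+1)·α₆ ≤ 1`**)
# — in place of the volume-leaf route's `δκ ≥ κ₀(64,8) + a₂ ≈ 326.6` and `α₆·e^{a₂}·K₀(64,8)·64 ≤ a₂` with `K₀(64,8) ∈ (10¹³⁹, 10¹⁴⁰)`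
# (cell `pub-balaban`, T4-DAG §2 node U3 / §6 rows NE9 ∕ NE5, census rows S-B13.11 ∕ S-B13.13 ∕ S-B13.24; NE9 formalisation swarm LEAF PROVER 05,
# lineage leaf-05, generation 4; part D of the lineage item «(1.26) direct on the torus model by a block-chain discretisation» — parts A
# `NE9TreeBlockChain` p212919, B1 `NE9TorusIneq126Chain` p213115, B2 `NE9TorusIneq126ChainSum` p213318, C `NE9RecordIneq126Chain` p213514)

HONEST FRAMING (T4-DAG PAGE 1).  Rung (B)+1 of the FINITE-VOLUME T⁴ programme — existence AND uniqueness of the ε → 0 limit of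
gauge-invariant observables on a fixed torus; NOT infinite volume, NOT a mass gap, NOT the Clay problem.  NE9 (`T4OutputRate.NE9` ∧
`FadingMemory`) is a cell NEW ESTIMATE, NOT PRINTED, and is NOT discharged here («NE9 ⇐ the named binders»); spine 0/9 unchanged; 0/18
leaves instantiated on Bałaban's objects.  HONEST DEPENDENCY (cell line, verbatim): continuum YM on T⁴ ⇐ BetaPertH ∧ nine spine estimates
(0/9 proved); BetaPertH ⇐ (D1) ∧ (D4) ∧ CAP+tail; G-an2-4 gates asym, D1 and NE2/3/4.  `FlowStep.BetaPertH`, (B), (B^μ) do not occur here.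
[II] = [Balaban1988RG2Cluster] is quoted for TYPES only (ABSOLUTE RULE: nothing printed in the audited series is asserted).  (1.26) and (2.29)
are PRINTED *"for κ sufficiently large (and α₆ sufficiently small)"* with unspecified constants; what moves is the CELL's certified pair on its
model of `d_j` (`TreeLengthTorus.torusTreeLen` ∕ `tsys`, reading D-pv22g2.1, sup-metric convention D-pv22.1 (i)).

WHY.  Unit pv03's `B12TreeDecay.ineq229_of_volumeLeaf` (on the torus `TreeLengthTorus.ineq229_torus`) feeds unit pv18's family-sum mechanism
`B13FamilySum.ineq229` with the VOLUME-LEAF (1.26) `(κ₀(4·2^d, 2d), K₀(4·2^d, 2d))`; census row S-B13.11 therefore reads `δκ ≥ κ₀ + a₂`,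
`α₆·e^{a₂}·K₀·c₀ ≤ a₂` with `κ₀ = 64·log 162 ≈ 325.6`, `K₀ = 162⁶⁴/81 ≈ 10^{139.5}` for d = 4.  THIS FILE feeds the SAME mechanism with part B2's
block-chain socket instead (kernel, no new definition, no `def … : Prop`, 0 sorry; `B13FamilySum.ineq229_locDomainSys`,
`B12TreeDecay.familySum_volBound_iff`∕`familySum_ineq126_iff`, `TreeLengthTorus.tvolumeLeaf` BY NAME):
* §1 `ineq126_univ_chain`: part B2's `ineq126_chain` transported to the whole torus catalogue `Finset.univ : Finset (tsys d N).Dom` with the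
  footprints `(tcubeSys d N).cubes` (the `Finset.sum_bij` of `TreeLengthTorus.sum_exp_torusTreeLen_le`), and `ineq126Printed_chain`: the
  `B12TreeDecay.CubeSystem.Ineq126Printed` ∕ `hTree` SHAPE of unit pv03 at `(κ, 2^d·2^(2^d) + 2^{d+1}Γ³e^{−(κ−κ₁)})`, `κ ≥ κ₁ + 1`;
* §2 **`ineq229_chain_torus`**: (2.29) on the torus system for `δκ ≥ κ₁(d) + s′ + a₂` (`s′ ≥ 1`, `a₂ ≥ 0`) and
  `α₆·e^{a₂}·(2^d·2^(2^d) + 2^{d+1}·Γ_d³·e^{−s′})·(4·2^d) ≤ a₂`; the corner **`ineq229_chain_torus_four`**: d = 4, `δκ ≥ 145` and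
  `e·(2²⁰ + 1)·64·α₆ ≤ 1` suffice (part B2's `kappa₁_four_lt`, `socketConst_four_lt_exp`) — versus `δκ ≥ 326.6`, `e·K₀(64,8)·64·α₆ ≤ 1` for
  pv22's `ineq229_torus_unit`.
DISGUISE TEST: real arithmetic over part B2's socket and pv18's family-sum theorem; no activity, no history — not NE9, not NE5.

References (TYPES only): T. Bałaban, *Renormalization group approach to lattice gauge field theories. II. Cluster expansions*, Commun.
Math. Phys. **116**, 1–22 (1988) [Balaban1988RG2Cluster], (1.26) p. 8, (2.29) p. 18 (*"For κ sufficiently large and α₆ sufficiently small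
we have Σ_𝐃 Π_{Y∈𝐃} α₆ exp(−δκ d_k(Y)) ≦ 1. (2.29)"*, quoted from the tree module `B13FamilySum`'s docstring, render p018 re-read by unit
pv18).  Summits-side NEW work (LEAN PLACEMENT RULE); imports part B2 only; modifies nothing.  Value = the census pair of S-B13.11 on the torus
brought from `(326.6, 10^{139.5})` to `(145, 2²⁰ + 1)` by a theorem of the cell's geometry, NOT summit progress.
-/

noncomputable section

open scoped BigOperators

namespace Summit.QuantumFields.BalabanUV.T4Continuum.NE9TorusIneq229Chain

open Literature.MathematicalPhysics.QuantumFieldTheory.Balaban1983to89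
open Literature.MathematicalPhysics.QuantumFieldTheory.Balaban1983to89.TreeLengthTorus
open Literature.MathematicalPhysics.QuantumFieldTheory.Balaban1983to89.B13FamilySum (Ineq126 Ineq229 VolBound ineq229_locDomainSys)
open Literature.MathematicalPhysics.QuantumFieldTheory.Balaban1983to89.B12TreeDecay (familySum_volBound_iff familySum_ineq126_iff)
open Summit.QuantumFields.BalabanUV.T4Continuum.NE9TorusIneq126Chain (chainConst kappa₁ chainConst_pos)
open Summit.QuantumFields.BalabanUV.T4Continuum.NE9TorusIneq126ChainSum
  (ineq126_chain kappa₁_four_lt socketConst_four_lt_exp)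

variable {d N : ℕ}

/-! ## §1 The block-chain (1.26) over the whole torus catalogue, and its `Ineq126Printed` ∕ `hTree` shape -/

/-- **(1.26), BLOCK-CHAIN SOCKET, OVER THE WHOLE TORUS CATALOGUE** `𝐃 = Finset.univ : Finset (tsys d N).Dom` with the footprints of
`tcubeSys`: for `κ ≥ κ₁(d) + 1`, `Ineq126 univ cubes d_j κ (2^d·2^(2^d) + 2^{d+1}Γ_d³·e^{−(κ−κ₁)})` (part B2's `ineq126_chain` over the image
catalogue, re-indexed by the subtype). [cite: Balaban1988RG2Cluster, (1.26) p.8] -/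
theorem ineq126_univ_chain (d N : ℕ) [NeZero N] {κ : ℝ} (hκ : kappa₁ d + 1 ≤ κ) :
    Ineq126 (Finset.univ : Finset (tsys d N).Dom) (tcubeSys d N).cubes (tsys d N).dj κ
      (2 ^ d * 2 ^ (2 ^ d) + 2 ^ (d + 1) * chainConst d ^ 3 * Real.exp (-(κ - kappa₁ d))) := by
  classical
  intro c
  set S : Finset (Finset (TPt d N)) := (Finset.univ : Finset (TDom d N)).image Subtype.val with hSdef
  have hS : ∀ Y ∈ S, Y.Nonempty ∧ TFaceConnected Y := by
    intro Y hY
    obtain ⟨Z, -, rfl⟩ := Finset.mem_image.1 hY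
    exact Z.2
  have h := ineq126_chain S hS hκ c
  refine le_trans (le_of_eq ?_) h
  refine Finset.sum_bij (fun Z _ => Z.1) ?_ ?_ ?_ ?_
  · intro Z hZ
    have hq : c ∈ Z.1 := by
      have := (Finset.mem_filter.1 hZ).2
      rwa [tcubeSys_cubes] at this
    have hZu : Z ∈ (Finset.univ : Finset (TDom d N)) := Finset.mem_univ Z
    exact Finset.mem_filter.2 ⟨Finset.mem_image_of_mem Subtype.val hZu, hq⟩
  · intro Z _ Z' _ h
    exact Subtype.ext h
  · intro Y hY
    obtain ⟨hYS, hqY⟩ := Finset.mem_filter.1 hY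
    obtain ⟨Z, -, rfl⟩ := Finset.mem_image.1 hYS
    refine ⟨Z, Finset.mem_filter.2 ⟨Finset.mem_univ _, ?_⟩, rfl⟩
    rwa [tcubeSys_cubes]
  · intro Z _
    rfl

/-- The same in unit pv03's `CubeSystem.Ineq126Printed` ∕ `hTree` SHAPE (`∀ □, Σ_{X ∈ above □} exp(−κ·d_j X) ≤ O(1)`), through
`B12TreeDecay.familySum_ineq126_iff`: for `κ ≥ κ₁(d) + 1` the torus system satisfies `Ineq126Printed κ (2^d·2^(2^d) + 2^{d+1}Γ_d³e^{−(κ−κ₁)})`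
— a drop-in for `TreeLengthTorus.ineq126_torus` ∕ `hTree_torus` above `κ₁ + 1` (`< 81` for d = 4) instead of `κ₀(64,8) ≈ 325.6`.
[cite: Balaban1988RG2Cluster, (1.26) p.8] -/
theorem ineq126Printed_chain (d N : ℕ) [NeZero N] {κ : ℝ} (hκ : kappa₁ d + 1 ≤ κ) :
    (tcubeSys d N).Ineq126Printed κ (2 ^ d * 2 ^ (2 ^ d) + 2 ^ (d + 1) * chainConst d ^ 3 * Real.exp (-(κ - kappa₁ d))) :=
  (familySum_ineq126_iff (tcubeSys d N) κ _).1 (ineq126_univ_chain d N hκ)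

/-! ## §2 (2.29) on the torus system from the block-chain socket -/

/-- **[II] (2.29) ON THE TORUS SYSTEM, BLOCK-CHAIN CONSTANTS** (verbatim TYPE: *"For κ sufficiently large and α₆ sufficiently small we
have Σ_𝐃 Π_{Y∈𝐃} α₆ exp(−δκ d_k(Y)) ≦ 1. (2.29)"*): for `s′ ≥ 1`, `a₂ ≥ 0`, `α₆ ≥ 0`, the rate condition `κ₁(d) + s′ + a₂ ≤ δκ` and the
smallness `α₆·e^{a₂}·(2^d·2^(2^d) + 2^{d+1}·Γ_d³·e^{−s′})·(4·2^d) ≤ a₂` give `Ineq229 univ cubes d_j α₆ (δκ)` on the torus system — unit pv18's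
`B13FamilySum.ineq229_locDomainSys` fed with §1 at the rate `κ₁ + s′` and with pv22's volume leaf `tvolumeLeaf` (`c₁ = 4·2^d`).
[cite: Balaban1988RG2Cluster, (2.29) p.18] -/
theorem ineq229_chain_torus (d N : ℕ) [NeZero N] (δ κ α₆ a₂ s' : ℝ) (hα₆ : 0 ≤ α₆) (ha₂ : 0 ≤ a₂) (hs' : 1 ≤ s')
    (hκ : kappa₁ d + s' + a₂ ≤ δ * κ)
    (hsmall : α₆ * Real.exp a₂ * (2 ^ d * 2 ^ (2 ^ d) + 2 ^ (d + 1) * chainConst d ^ 3 * Real.exp (-s')) * (4 * 2 ^ d) ≤ a₂) :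
    Ineq229 (Finset.univ : Finset (tsys d N).Dom) (tcubeSys d N).cubes (tsys d N).dj α₆ (δ * κ) := by
  have h126 : Ineq126 (Finset.univ : Finset (tsys d N).Dom) (tcubeSys d N).cubes (tsys d N).dj (kappa₁ d + s')
      (2 ^ d * 2 ^ (2 ^ d) + 2 ^ (d + 1) * chainConst d ^ 3 * Real.exp (-s')) := by
    have h := ineq126_univ_chain d N (κ := kappa₁ d + s') (by linarith)
    rwa [show -(kappa₁ d + s' - kappa₁ d) = -s' by ring] at h
  exact ineq229_locDomainSys (tsys d N) (tcubeSys d N).cubes (kappa₁ d + s')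
    (2 ^ d * 2 ^ (2 ^ d) + 2 ^ (d + 1) * chainConst d ^ 3 * Real.exp (-s')) (4 * 2 ^ d) δ κ α₆ a₂
    (fun Y => ((tcubeSys d N).connected Y).1) ((familySum_volBound_iff (tcubeSys d N) (4 * 2 ^ d)).2 (tvolumeLeaf d N))
    h126 hα₆ ha₂ (by positivity) hκ hsmall

/-- **THE d = 4 CORNER OF (2.29)** (`s′ = 64`, `a₂ = 1`): on the torus system of `(ℤ/N)⁴`, **`δκ ≥ 145`** and **`e·(2²⁰ + 1)·64·α₆ ≤ 1`**
give (2.29) — versus pv22's `ineq229_torus_unit`: `δκ ≥ κ₀(64,8) + 1 ≈ 326.6` and `e·K₀(64,8)·64·α₆ ≤ 1`, `K₀(64,8) ∈ (10¹³⁹, 10¹⁴⁰)`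
(`kappa₁_four_lt`: κ₁(4) < 80; `socketConst_four_lt_exp`: 2⁵Γ₄³e^{−64} < 1). [cite: Balaban1988RG2Cluster, (2.29) p.18] -/
theorem ineq229_chain_torus_four (N : ℕ) [NeZero N] (δ κ α₆ : ℝ) (hα₆ : 0 ≤ α₆) (hκ : 145 ≤ δ * κ)
    (hsmall : Real.exp 1 * (2 ^ 20 + 1) * 64 * α₆ ≤ 1) :
    Ineq229 (Finset.univ : Finset (tsys 4 N).Dom) (tcubeSys 4 N).cubes (tsys 4 N).dj α₆ (δ * κ) := by
  have hk := kappa₁_four_lt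
  have htail : (2 : ℝ) ^ (4 + 1) * chainConst 4 ^ 3 * Real.exp (-64) ≤ 1 := by
    have h2 := socketConst_four_lt_exp
    have h3 : (0 : ℝ) ≤ 2 ^ (4 + 1) * chainConst 4 ^ 3 := by
      have := chainConst_pos 4
      positivity
    calc (2 : ℝ) ^ (4 + 1) * chainConst 4 ^ 3 * Real.exp (-64)
        ≤ Real.exp 64 * Real.exp (-64) := mul_le_mul_of_nonneg_right h2.le (Real.exp_pos _).le
      _ = 1 := by rw [← Real.exp_add]; norm_num
  have hC : (2 : ℝ) ^ 4 * 2 ^ (2 ^ 4) + 2 ^ (4 + 1) * chainConst 4 ^ 3 * Real.exp (-64) ≤ 2 ^ 20 + 1 := by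
    norm_num at htail ⊢
    linarith
  have hC0 : (0 : ℝ) ≤ 2 ^ 4 * 2 ^ (2 ^ 4) + 2 ^ (4 + 1) * chainConst 4 ^ 3 * Real.exp (-64) := by
    have := chainConst_pos 4
    positivity
  refine ineq229_chain_torus 4 N δ κ α₆ 1 64 hα₆ zero_le_one (by norm_num) (by linarith) ?_
  have he : (0 : ℝ) ≤ α₆ * Real.exp 1 := mul_nonneg hα₆ (Real.exp_pos 1).le
  calc α₆ * Real.exp 1 * (2 ^ 4 * 2 ^ (2 ^ 4) + 2 ^ (4 + 1) * chainConst 4 ^ 3 * Real.exp (-64)) * (4 * 2 ^ 4)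
      ≤ α₆ * Real.exp 1 * (2 ^ 20 + 1) * (4 * 2 ^ 4) := by
        have := mul_le_mul_of_nonneg_left hC he
        nlinarith
    _ = Real.exp 1 * (2 ^ 20 + 1) * 64 * α₆ := by ring
    _ ≤ 1 := hsmall

end Summit.QuantumFields.BalabanUV.T4Continuum.NE9TorusIneq229Chain

end
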